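import Summits.AtomisticToContinuum.HydrodynamicLimit.Theses.OneFlightGossipEngine
import Summits.AtomisticToContinuum.HydrodynamicLimit.Theorems.BoltzmannGreenKubo.Negative.ForallN
import Summits.AtomisticToContinuum.HydrodynamicLimit.Theorems.ShearStressHalfDrude.Negative.WithoutOrth
import Literature.Analysis.FluidPDE.HardSphereAlexander
import Summits.AtomisticToContinuum.HydrodynamicLimit.Theorems.CorrectorPressureDecay.Negative.Frame

/-!
# `KineticCurrentsWindowLDUniform` for EVERY `N` (no `N₀`) is FALSE — one free sphere never decorrelates

Negative knowledge for the crux `OneFlightGossipEngine.KineticCurrentsWindowLDUniform`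
(stmt-AtomisticToContinuum-14662, the docking node KCW of route `OneFlightGossipEngine`: finite-kinetic-window
large deviations of the kinetic fast currents `F(x,v) = A(x):w⊗w + (b(x)·w) G(x,|w|²)`, `w = v − u₀(x)`, from local
Gibbs data, `η₀`-uniformly), from the standing disprover's `Cruxes/KineticCurrentsWindowLDUniform/Disproof.lean` § 1.

`KineticCurrentsWindowLDUniformAllN` is the crux VERBATIM with `∃ N₀, ∀ N ≥ N₀` strengthened to `∀ N`, and it is
FALSE. Witness: `η₀` arbitrary, `a = θ₀ = 1`, `u₀ = 0`, `σ = min(1/4, η₀, 1)` (so `σ³·sup a ≤ η₀ ∫a`), the Alexander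
flows of the tree (`HardSphereFlow.nonempty_torus_holds`), `A = e₀ ⊗ e₁` (the kinetic shear stress `F = v₀v₁`, in the
crux's class: continuous, `|F| ≤ 1·(1+‖v‖²)`, orthogonal to `1, v_j, ‖v‖²` under `M_{1,0,1}` by the coordinate
reflections `v₀ ↦ −v₀`, `v₁ ↦ −v₁`), `b = 0`, `G = 0`, and `N = 0`: ONE sphere flies freely on its good set
(`BoltzmannGreenKuboForallN.flow_vel_eq`, reused), so for every window `τ` the window average of `F` is `F(v)` itself
and the functional is the STATIC exponential moment `I(β) = ∫ e^{β v₀v₁} dγ` (one-body Gibbs expectations are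
Gaussian, `ShearStressHalfDrudeNonCentred.lintegral_vel_localGibbsMeasure`, reused). By `e^{y} + e^{−y} ≥ 2 + y²/2`
(`CorrectorPressureDecayNegative.two_add_sq_div_two_le_exp_add_exp_neg`, reused),
`I(β₀) + I(−β₀) ≥ 2 + (β₀²/2)·J` with `J = E_γ[(v₀v₁)²] > 0`, while the statement at BOTH admissible signs `β = ±β₀`
and `ε = log(1 + β₀² min(J,1)/8)` gives `I(±β₀) ≤ e^{ε}`, i.e. `2 + (β₀²/2) min(J,1) ≤ 2 + (β₀²/4) min(J,1)`: absurd.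

Consequences for provers: (i) `N₀` is load-bearing — any proof must use the COLLISION mechanism quantitatively; no
argument insensitive to `N ≥ N₀` (equivalently valid for the ideal / one-particle gas) gives a pressure `< Λ_stat(β)`;
(ii) the static pressure per particle is `≥ log(1 + β²J/4) > 0` at every `β ≠ 0`, so the `τ`-window is what must
bring it below `ε`; (iii) `gShear`, `gShear_orth_*`, `abs_gShear_le` give provers a ready-made non-trivial instance of the
crux's hypotheses. refuter-cdisprove-stmt-AtomisticToContinuum-14662-0.
-/

noncomputable section

namespace Summit.AtomisticToContinuum.HydrodynamicLimit.Theorems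

open MeasureTheory ProbabilityTheory Real
open scoped ENNReal InnerProductSpace
open Literature.Analysis.FluidPDE Literature.MathematicalPhysics.KineticTheory

namespace KineticCurrentsWindowLDUniformOneSphere

open BoltzmannGreenKuboForallN
  (flow_vel_eq reflB reflB_apply integral_stdGaussian_eq_zero_of_odd norm_sq_eq_three)
open ShearStressHalfDrudeNonCentred (lintegral_vel_localGibbsMeasure)

/-! ### Frame, witness observable, Gaussian facts -/

/-- The hard-sphere flows of the crux: `N + 1` spheres of diameter `σ (N+1)^{-1/3}` on `𝕋³`. [folklore] -/
abbrev Flow (σ : ℝ) (N : ℕ) : Type :=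
  HardSphereFlow (Torus.geometry (Fin 3)) (hsDiameter σ N) (N + 1)

/-- A hard-sphere flow family at reduced diameter `σ < 1/2`, from the tree's Alexander theorem on `𝕋³`
(`HardSphereFlow.nonempty_torus_holds`): flows are CONSTRUCTIBLE, so every `¬`-lemma below is unconditional. [folklore] -/
def alexFlow {σ : ℝ} (hσ : 0 < σ) (hσ' : σ < 2⁻¹) (N : ℕ) : Flow σ N :=
  Classical.choice (HardSphereFlow.nonempty_torus_holds (d := Fin 3) (hsDiameter_pos hσ N)
    ((hsDiameter_le hσ.le N).trans_lt hσ') (N + 1))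

/-- The shear-stress coefficient field `A ≡ e₀ ⊗ e₁` (constant in `x`; traceless). [folklore] -/
def A01 : T3 → Fin 3 → Fin 3 → ℝ := fun _ j k => if j = 0 ∧ k = 1 then 1 else 0

/-- The kinetic shear stress `g(v) = v₀ v₁`. [folklore] -/
def gShear (v : V3) : ℝ := v 0 * v 1

/-- The shear stress is continuous. [folklore] -/
theorem continuous_gShear : Continuous gShear :=
  ((EuclideanSpace.proj (𝕜 := ℝ) (0 : Fin 3)).continuous).mul
    ((EuclideanSpace.proj (𝕜 := ℝ) (1 : Fin 3)).continuous)

/-- The crux functional `F` at `A = A01`, `b = 0`, `G = 0`, `u₀ = 0` is the shear stress `v₀ v₁`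
(stated in the beta-normal form the crux produces after instantiation). [folklore] -/
theorem F_A01 (x : T3) (v : V3) :
    ((∑ j : Fin 3, ∑ k : Fin 3, A01 x j k * ((v - 0) j * (v - 0) k)) +
      (∑ j : Fin 3, (0 : V3) j * (v - 0) j) * (0 : ℝ)) = gShear v := by
  simp [A01, gShear, Fin.sum_univ_three]

/-- `|v₀ v₁| ≤ 1 · (1 + ‖v‖²)`. [folklore] -/
theorem abs_gShear_le (v : V3) : |gShear v| ≤ 1 * (1 + ‖v‖ ^ 2) := by
  rw [gShear, one_mul, norm_sq_eq_three, abs_le]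
  constructor <;> nlinarith [sq_nonneg (v 0 + v 1), sq_nonneg (v 0 - v 1), sq_nonneg (v 2)]

/-- `g` is odd under `v₀ ↦ -v₀`. [folklore] -/
theorem gShear_reflB_zero (w : V3) : gShear (reflB 0 w) = -gShear w := by
  simp [gShear, reflB_apply]

/-- `g` is odd under `v₁ ↦ -v₁`. [folklore] -/
theorem gShear_reflB_one (w : V3) : gShear (reflB 1 w) = -gShear w := by
  simp [gShear, reflB_apply]

/-- Maxwellian-weighted Lebesgue integrals are standard-Gaussian integrals. [folklore] -/
theorem integral_mul_localMaxwellian_eq (h : V3 → ℝ) :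
    ∫ v, h v * localMaxwellian 1 1 (0 : V3) v = ∫ v, h v ∂stdGaussian V3 := by
  rw [localMaxwellian_one_one_zero, integral_stdGaussian_eq_integral_mul_globalMaxwellian]
  simp_rw [mul_comm]

/-- Orthogonality of the shear stress to `1` (odd under `v₀ ↦ -v₀`). [folklore] -/
theorem gShear_orth_one : ∫ v, gShear v * localMaxwellian 1 1 (0 : V3) v = 0 := by
  rw [integral_mul_localMaxwellian_eq]
  exact integral_stdGaussian_eq_zero_of_odd (reflB 0) gShear_reflB_zero

/-- Orthogonality of the shear stress to `v_j` (odd under `v₁ ↦ -v₁` for `j = 0`, under `v₀ ↦ -v₀` otherwise). [folklore] -/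
theorem gShear_orth_mom (j : Fin 3) : ∫ v, gShear v * v j * localMaxwellian 1 1 (0 : V3) v = 0 := by
  rw [integral_mul_localMaxwellian_eq]
  fin_cases j
  · refine integral_stdGaussian_eq_zero_of_odd (reflB 1) fun w => ?_
    simp [gShear, reflB_apply]
  · refine integral_stdGaussian_eq_zero_of_odd (reflB 0) fun w => ?_
    simp [gShear, reflB_apply]
  · refine integral_stdGaussian_eq_zero_of_odd (reflB 0) fun w => ?_
    simp [gShear, reflB_apply]

/-- Orthogonality of the shear stress to `‖v‖²` (odd under `v₀ ↦ -v₀`, which preserves the norm). [folklore] -/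
theorem gShear_orth_energy : ∫ v, gShear v * ‖v‖ ^ 2 * localMaxwellian 1 1 (0 : V3) v = 0 := by
  rw [integral_mul_localMaxwellian_eq]
  refine integral_stdGaussian_eq_zero_of_odd (reflB 0) fun w => ?_
  rw [gShear_reflB_zero, LinearIsometryEquiv.norm_map]
  ring

/-- `γ{v₀ v₁ ≠ 0} > 0`: Lebesgue measure is absolutely continuous w.r.t. the standard Gaussian
(positive Maxwellian density) and the set is open and nonempty. [folklore] -/
theorem stdGaussian_support_gShear_pos : 0 < stdGaussian V3 {w | gShear w ≠ 0} := by
  have hac : (volume : Measure V3) ≪ stdGaussian V3 := by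
    rw [show stdGaussian V3 = _ from stdGaussian_eq_withDensity_globalMaxwellian_holds]
    exact withDensity_absolutelyContinuous'
      continuous_globalMaxwellian.measurable.ennreal_ofReal.aemeasurable
      (Filter.Eventually.of_forall fun v => (ENNReal.ofReal_pos.2 (globalMaxwellian_pos v)).ne')
  have hopen : IsOpen {w : V3 | gShear w ≠ 0} := isOpen_ne_fun continuous_gShear continuous_const
  have hne : ({w : V3 | gShear w ≠ 0}).Nonempty := by
    refine ⟨WithLp.toLp 2 fun _ : Fin 3 => (1 : ℝ), ?_⟩
    simp [gShear]
  have hvol : (volume : Measure V3) {w | gShear w ≠ 0} ≠ 0 := (hopen.measure_pos volume hne).ne'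
  exact pos_iff_ne_zero.2 fun h0 => hvol (hac h0)

/-- `J = ∫ ofReal(g²) dγ > 0`. [folklore] -/
theorem lintegral_gShear_sq_pos : 0 < ∫⁻ w, ENNReal.ofReal (gShear w ^ 2) ∂stdGaussian V3 := by
  have hm : Measurable fun w : V3 => ENNReal.ofReal (gShear w ^ 2) :=
    (continuous_gShear.pow 2).measurable.ennreal_ofReal
  rw [lintegral_pos_iff_support hm]
  refine stdGaussian_support_gShear_pos.trans_le (measure_mono fun w hw => ?_)
  simp only [Set.mem_setOf_eq] at hw
  simp only [Function.mem_support, ne_eq, ENNReal.ofReal_eq_zero, not_le]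
  positivity

/-! ### One sphere: the window functional is static -/

/-- For `N = 0` (ONE sphere, free flight on the good set) the kinetic-window functional of any velocity
observable is its STATIC exponential moment, whatever the window. [folklore] -/
theorem window_N0_exp {σ : ℝ} (Φ : Flow σ 0) {w : ℝ} (hw : 0 < w) (β : ℝ) (Fv : V3 → ℝ) :
    ∫⁻ z, ENNReal.ofReal (Real.exp (β * ∑ i, w⁻¹ * ∫ r in (0 : ℝ)..w, Fv ((Φ.flow r z) i).2))
        ∂(localGibbsLaw σ (fun _ => 1) (fun _ => 0) (fun _ => 1) 0 Φ) =
      ∫⁻ z, ENNReal.ofReal (Real.exp (β * Fv ((z 0).2)))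
        ∂(localGibbsLaw σ (fun _ => 1) (fun _ => 0) (fun _ => 1) 0 Φ) := by
  have hgood : ∀ᵐ z ∂(localGibbsLaw σ (fun _ => 1) (fun _ => 0) (fun _ => 1) 0 Φ), z ∈ Φ.good := by
    unfold localGibbsLaw
    rw [particleLaw_eq]
    exact (withDensity_absolutelyContinuous _ _).ae_le Φ.ae_mem_good
  refine lintegral_congr_ae ?_
  filter_upwards [hgood] with z hz
  have hterm : ∀ i : Fin (0 + 1), w⁻¹ * ∫ r in (0 : ℝ)..w, Fv ((Φ.flow r z) i).2 = Fv ((z i).2) := by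
    intro i
    have hint : ∫ r in (0 : ℝ)..w, Fv ((Φ.flow r z) i).2 = ∫ r in (0 : ℝ)..w, Fv ((z i).2) := by
      refine intervalIntegral.integral_congr fun r hr => ?_
      rw [Set.uIcc_of_le hw.le] at hr
      rw [flow_vel_eq Φ hz hr.1 i]
    rw [hint, intervalIntegral.integral_const, smul_eq_mul, sub_zero, ← mul_assoc,
      inv_mul_cancel₀ hw.ne', one_mul]
  simp_rw [hterm]
  simp

/-- The static exponential moment `I(β) = ∫ ofReal(e^{β v₀ v₁}) dγ`. [folklore] -/
def Istat (β : ℝ) : ℝ≥0∞ := ∫⁻ w, ENNReal.ofReal (Real.exp (β * gShear w)) ∂stdGaussian V3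

/-- `I(β) + I(-β) ≥ 2 + (β²/2) J` (`cosh ≥ 1 + x²/2` under the integral). [folklore] -/
theorem two_add_le_Istat_add (β : ℝ) :
    2 + ENNReal.ofReal (β ^ 2 / 2) * ∫⁻ w, ENNReal.ofReal (gShear w ^ 2) ∂stdGaussian V3 ≤
      Istat β + Istat (-β) := by
  have hm1 : Measurable fun w : V3 => ENNReal.ofReal (Real.exp (β * gShear w)) :=
    ((continuous_const.mul continuous_gShear).rexp).measurable.ennreal_ofReal
  have hm2 : Measurable fun w : V3 => ENNReal.ofReal (gShear w ^ 2) :=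
    (continuous_gShear.pow 2).measurable.ennreal_ofReal
  have hpt : ∀ w : V3, (2 : ℝ≥0∞) + ENNReal.ofReal (β ^ 2 / 2) * ENNReal.ofReal (gShear w ^ 2) ≤
      ENNReal.ofReal (Real.exp (β * gShear w)) + ENNReal.ofReal (Real.exp (-β * gShear w)) := by
    intro w
    have e1 : (2 : ℝ≥0∞) + ENNReal.ofReal (β ^ 2 / 2) * ENNReal.ofReal (gShear w ^ 2) =
        ENNReal.ofReal (2 + β ^ 2 / 2 * gShear w ^ 2) := by
      rw [ENNReal.ofReal_add (by norm_num) (by positivity), ENNReal.ofReal_mul (by positivity),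
        ENNReal.ofReal_ofNat]
    rw [e1, ← ENNReal.ofReal_add (Real.exp_pos _).le (Real.exp_pos _).le]
    refine ENNReal.ofReal_le_ofReal ?_
    have := CorrectorPressureDecayNegative.two_add_sq_div_two_le_exp_add_exp_neg (β * gShear w)
    have e : β ^ 2 / 2 * gShear w ^ 2 = (β * gShear w) ^ 2 / 2 := by ring
    rw [e, show -β * gShear w = -(β * gShear w) by ring]
    exact this
  calc (2 : ℝ≥0∞) + ENNReal.ofReal (β ^ 2 / 2) * ∫⁻ w, ENNReal.ofReal (gShear w ^ 2) ∂stdGaussian V3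
      = ∫⁻ w, (2 + ENNReal.ofReal (β ^ 2 / 2) * ENNReal.ofReal (gShear w ^ 2)) ∂stdGaussian V3 := by
        rw [lintegral_add_left measurable_const, lintegral_const, measure_univ, mul_one,
          lintegral_const_mul _ hm2]
    _ ≤ ∫⁻ w, (ENNReal.ofReal (Real.exp (β * gShear w)) + ENNReal.ofReal (Real.exp (-β * gShear w)))
          ∂stdGaussian V3 := lintegral_mono hpt
    _ = Istat β + Istat (-β) := by
        rw [lintegral_add_left hm1]
        rfl

end KineticCurrentsWindowLDUniformOneSphere

open KineticCurrentsWindowLDUniformOneSphere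
open ShearStressHalfDrudeNonCentred (lintegral_vel_localGibbsMeasure)

/-! ### The strengthening without `N₀` -/

/-- **A FALSE proposition — NOT a citable fact.** The crux `OneFlightGossipEngine.KineticCurrentsWindowLDUniform`
(stmt-AtomisticToContinuum-14662) VERBATIM with the restriction to large `N` removed (`∃ N₀, ∀ N ≥ N₀` ↦ `∀ N`);
kept only as the statement that `not_kineticCurrentsWindowLDUniformAllN` negates (NO provenance tag on purpose — it is not a fact to vendor or relocate; load-bearing analysis: collisions /
`N ≥ N₀` are necessary). -/
def KineticCurrentsWindowLDUniformAllN : Prop :=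
  ∃ η₀ : ℝ, 0 < η₀ ∧ ∀ (a θ₀ : Literature.MathematicalPhysics.KineticTheory.T3 → ℝ) (u₀ : Literature.MathematicalPhysics.KineticTheory.T3 → Literature.MathematicalPhysics.KineticTheory.V3), Continuous a → Continuous θ₀ → Continuous u₀ → (∀ x, 0 < a x) → (∀ x, 0 < θ₀ x) → ∀ σ : ℝ, 0 < σ → σ ^ 3 * (⨆ x, a x) ≤ η₀ * ∫ x, a x → ∀ Φ : (N : ℕ) → Literature.Analysis.FluidPDE.HardSphereFlow (Literature.Analysis.FluidPDE.Torus.geometry (Fin 3)) (Literature.MathematicalPhysics.KineticTheory.hsDiameter σ N) (N + 1), ∀ (A : Literature.MathematicalPhysics.KineticTheory.T3 → Fin 3 → Fin 3 → ℝ) (b : Literature.MathematicalPhysics.KineticTheory.T3 → Literature.MathematicalPhysics.KineticTheory.V3) (G : Literature.MathematicalPhysics.KineticTheory.T3 × ℝ → ℝ), Continuous A → Continuous b → Continuous G → (∃ C : ℝ, ∀ y : Literature.MathematicalPhysics.KineticTheory.T3 × Literature.MathematicalPhysics.KineticTheory.V3, |(fun y : Literature.MathematicalPhysics.KineticTheory.T3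 × Literature.MathematicalPhysics.KineticTheory.V3 => ((∑ j : Fin 3, ∑ k : Fin 3, A y.1 j k * ((y.2 - u₀ y.1) j * (y.2 - u₀ y.1) k)) + (∑ j : Fin 3, b y.1 j * (y.2 - u₀ y.1) j) * G (y.1, ‖y.2 - u₀ y.1‖ ^ 2))) y| ≤ C * (1 + ‖y.2‖ ^ 2)) → (∀ x, ∫ v, (fun y : Literature.MathematicalPhysics.KineticTheory.T3 × Literature.MathematicalPhysics.KineticTheory.V3 => ((∑ j : Fin 3, ∑ k : Fin 3, A y.1 j k * ((y.2 - u₀ y.1) j * (y.2 - u₀ y.1) k)) + (∑ j : Fin 3, b y.1 j * (y.2 - u₀ y.1) j) * G (y.1, ‖y.2 - u₀ y.1‖ ^ 2))) (x, v) * Literature.Analysis.FluidPDE.localMaxwellian 1 (θ₀ x) (u₀ x) v = 0) → (∀ x (j : Fin 3), ∫ v, (fun y : Literature.MathematicalPhysics.KineticTheory.T3 × Literature.MathematicalPhysics.KineticTheory.V3 => ((∑ j : Fin 3, ∑ k : Fin 3, A y.1 j k * ((y.2 - u₀ y.1) j * (y.2 - u₀ y.1) k)) + (∑ j : Fin 3,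 b y.1 j * (y.2 - u₀ y.1) j) * G (y.1, ‖y.2 - u₀ y.1‖ ^ 2))) (x, v) * v j * Literature.Analysis.FluidPDE.localMaxwellian 1 (θ₀ x) (u₀ x) v = 0) → (∀ x, ∫ v, (fun y : Literature.MathematicalPhysics.KineticTheory.T3 × Literature.MathematicalPhysics.KineticTheory.V3 => ((∑ j : Fin 3, ∑ k : Fin 3, A y.1 j k * ((y.2 - u₀ y.1) j * (y.2 - u₀ y.1) k)) + (∑ j : Fin 3, b y.1 j * (y.2 - u₀ y.1) j) * G (y.1, ‖y.2 - u₀ y.1‖ ^ 2))) (x, v) * ‖v‖ ^ 2 * Literature.Analysis.FluidPDE.localMaxwellian 1 (θ₀ x) (u₀ x) v = 0) → ∃ β₀ : ℝ, 0 < β₀ ∧ ∀ β : ℝ, |β| ≤ β₀ → ∀ ε : ℝ, 0 < ε → ∃ τ : ℝ, 0 < τ ∧ ∀ N : ℕ, ∫⁻ z, ENNReal.ofReal (Real.exp (β * ∑ i : Fin (N + 1), (τ * ((N : ℝ) + 1) ^ (-(1 / 3 : ℝ)))⁻¹ * ∫ r in (0 : ℝ)..(τ * ((N : ℝ) + 1)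 ^ (-(1 / 3 : ℝ))), (fun y : Literature.MathematicalPhysics.KineticTheory.T3 × Literature.MathematicalPhysics.KineticTheory.V3 => ((∑ j : Fin 3, ∑ k : Fin 3, A y.1 j k * ((y.2 - u₀ y.1) j * (y.2 - u₀ y.1) k)) + (∑ j : Fin 3, b y.1 j * (y.2 - u₀ y.1) j) * G (y.1, ‖y.2 - u₀ y.1‖ ^ 2))) (((Φ N).flow r z) i))) ∂(Literature.MathematicalPhysics.KineticTheory.localGibbsLaw σ a u₀ θ₀ N (Φ N)) ≤ ENNReal.ofReal (Real.exp (ε * ((N : ℝ) + 1)))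

/-- **THE "FOR EVERY `N`" STRENGTHENING IS FALSE** (so `∃ N₀` is load-bearing: no argument insensitive to
`N ≥ N₀` — equivalently valid for the ideal / one-particle gas — can prove the crux). Witness: `η₀` arbitrary,
`a = θ₀ = 1`, `u₀ = 0`, `σ = min(1/4, η₀, 1)`, the Alexander flows, `A = e₀ ⊗ e₁` (`F = v₀v₁`), `b = 0`, `G = 0`;
at `N = 0` the single sphere flies freely, the window average of `F` is `F(v)` for every `τ`, and
`I(β₀) + I(-β₀) ≥ 2 + (β₀²/2)·J`, `J = E_γ[(v₀v₁)²] > 0`, contradicts the bound `≤ e^{ε}` at BOTH signs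
`β = ±β₀` once `2e^{ε} < 2 + (β₀²/2) J`. [folklore] -/
theorem not_kineticCurrentsWindowLDUniformAllN : ¬ KineticCurrentsWindowLDUniformAllN := by
  rintro ⟨η₀, hη₀, h⟩
  -- parameters
  set σ : ℝ := min (1 / 4) (min η₀ 1) with hσdef
  have hσpos : 0 < σ := lt_min (by norm_num) (lt_min hη₀ one_pos)
  have hσ4 : σ ≤ 1 / 4 := min_le_left _ _
  have hση : σ ≤ η₀ := (min_le_right _ _).trans (min_le_left _ _)
  have hσ1 : σ ≤ 1 := (min_le_right _ _).trans (min_le_right _ _)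
  have hσhalf : σ ≤ 1 / 2 := hσ4.trans (by norm_num)
  have hσhalf' : σ < 2⁻¹ := hσ4.trans_lt (by norm_num)
  have hguard : σ ^ 3 * (⨆ _x : T3, (1 : ℝ)) ≤ η₀ * ∫ _x : T3, (1 : ℝ) := by
    have hsup : (⨆ _x : T3, (1 : ℝ)) = 1 := ciSup_const
    have hint : ∫ _x : T3, (1 : ℝ) = 1 := by simp
    rw [hsup, hint, mul_one, mul_one]
    calc σ ^ 3 ≤ σ := by
          have : σ ^ 3 ≤ σ ^ 1 := pow_le_pow_of_le_one hσpos.le hσ1 (by norm_num)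
          simpa using this
      _ ≤ η₀ := hση
  have hmain := h (fun _ => 1) (fun _ => 1) (fun _ => 0) continuous_const continuous_const
    continuous_const (fun _ => one_pos) (fun _ => one_pos) σ hσpos hguard (alexFlow hσpos hσhalf')
    A01 (fun _ => 0) (fun _ => 0) continuous_const continuous_const continuous_const
  have hmain' : (∃ C : ℝ, ∀ y : T3 × V3, |gShear y.2| ≤ C * (1 + ‖y.2‖ ^ 2)) →
      (∀ x : T3, ∫ v, gShear v * localMaxwellian 1 1 (0 : V3) v = 0) →
      (∀ (x : T3) (j : Fin 3), ∫ v, gShear v * v j * localMaxwellian 1 1 (0 : V3) v = 0) →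
      (∀ x : T3, ∫ v, gShear v * ‖v‖ ^ 2 * localMaxwellian 1 1 (0 : V3) v = 0) →
      ∃ β₀ : ℝ, 0 < β₀ ∧ ∀ β : ℝ, |β| ≤ β₀ → ∀ ε : ℝ, 0 < ε → ∃ τ : ℝ, 0 < τ ∧ ∀ N : ℕ,
        ∫⁻ z, ENNReal.ofReal (Real.exp (β * ∑ i : Fin (N + 1), (τ * ((N : ℝ) + 1) ^ (-(1 / 3 : ℝ)))⁻¹ *
          ∫ r in (0 : ℝ)..(τ * ((N : ℝ) + 1) ^ (-(1 / 3 : ℝ))),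
            gShear (((alexFlow hσpos hσhalf' N).flow r z) i).2))
          ∂(localGibbsLaw σ (fun _ => 1) (fun _ => 0) (fun _ => 1) N (alexFlow hσpos hσhalf' N)) ≤
        ENNReal.ofReal (Real.exp (ε * ((N : ℝ) + 1))) := by
    simpa only [F_A01] using hmain
  clear hmain h
  obtain ⟨β₀, hβ₀, hβ⟩ := hmain' ⟨1, fun y => abs_gShear_le y.2⟩ (fun _ => gShear_orth_one)
    (fun _ j => gShear_orth_mom j) (fun _ => gShear_orth_energy)
  -- the positive second moment, truncated to be finite
  set J : ℝ≥0∞ := ∫⁻ w, ENNReal.ofReal (gShear w ^ 2) ∂stdGaussian V3 with hJ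
  set J' : ℝ≥0∞ := min J 1 with hJ'
  have hJ'pos : 0 < J' := lt_min lintegral_gShear_sq_pos one_pos
  have hJ'top : J' ≠ ⊤ := (min_le_right _ _).trans_lt ENNReal.one_lt_top |>.ne
  have hJ'le : J' ≤ J := min_le_left _ _
  set j : ℝ := J'.toReal with hj
  have hjpos : 0 < j := ENNReal.toReal_pos hJ'pos.ne' hJ'top
  set ε : ℝ := Real.log (1 + β₀ ^ 2 / 8 * j) with hεdef
  have hc : 0 < β₀ ^ 2 / 8 * j := by positivity
  have hε : 0 < ε := Real.log_pos (by linarith)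
  have hexpε : Real.exp ε = 1 + β₀ ^ 2 / 8 * j := by
    rw [hεdef, Real.exp_log (by linarith)]
  -- the two signs
  have key : ∀ β : ℝ, |β| ≤ β₀ → Istat β ≤ ENNReal.ofReal (Real.exp ε) := by
    intro β hβle
    obtain ⟨τ, hτ, hN⟩ := hβ β hβle ε hε
    have h0 := hN 0
    have hw : (τ * (((0 : ℕ) : ℝ) + 1) ^ (-(1 / 3 : ℝ))) = τ := by simp
    rw [hw] at h0
    rw [window_N0_exp (alexFlow hσpos hσhalf' 0) hτ β gShear, localGibbsLaw_eq,
      lintegral_vel_localGibbsMeasure hσhalf 0 0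
        (H := fun w => ENNReal.ofReal (Real.exp (β * gShear w)))
        (((continuous_const.mul continuous_gShear).rexp).measurable.ennreal_ofReal)] at h0
    unfold Istat
    simpa using h0
  have k1 := key β₀ (by rw [abs_of_pos hβ₀])
  have k2 := key (-β₀) (by rw [abs_neg, abs_of_pos hβ₀])
  have hsum := (two_add_le_Istat_add β₀).trans (add_le_add k1 k2)
  -- compare in `ℝ≥0∞`
  have hL : (2 : ℝ≥0∞) + ENNReal.ofReal (β₀ ^ 2 / 2) * J' ≤ 2 + ENNReal.ofReal (β₀ ^ 2 / 2) * J :=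
    add_le_add le_rfl (mul_le_mul' le_rfl hJ'le)
  have hfin := hL.trans hsum
  have hJ'j : J' = ENNReal.ofReal j := by rw [hj, ENNReal.ofReal_toReal hJ'top]
  have hlhs : (2 : ℝ≥0∞) + ENNReal.ofReal (β₀ ^ 2 / 2) * J' = ENNReal.ofReal (2 + β₀ ^ 2 / 2 * j) := by
    rw [hJ'j, ENNReal.ofReal_add (by norm_num) (by positivity), ENNReal.ofReal_mul (by positivity),
      ENNReal.ofReal_ofNat]
  have hrhs : ENNReal.ofReal (Real.exp ε) + ENNReal.ofReal (Real.exp ε) =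
      ENNReal.ofReal (2 + β₀ ^ 2 / 4 * j) := by
    rw [← ENNReal.ofReal_add (Real.exp_pos _).le (Real.exp_pos _).le, hexpε]
    congr 1
    ring
  rw [hlhs, hrhs, ENNReal.ofReal_le_ofReal_iff (by positivity)] at hfin
  nlinarith [hfin, hjpos, hβ₀, sq_nonneg β₀, mul_pos (pow_pos hβ₀ 2) hjpos]


end Summit.AtomisticToContinuum.HydrodynamicLimit.Theorems

end
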